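import Literature.Probability.RandomPlanarGeometry.CaratheodoryContinuity
import Literature.Probability.RandomPlanarGeometry.HalfPlaneAutomorphism
import HarnessLib

/-!
# Carathéodory's theorem for Jordan domains (`JordanDomain.exists_continuousOn_extension` holds)

This file discharges the named fact `Literature.Probability.RandomPlanarGeometry.JordanDomain.exists_continuousOn_extension` of
`Literature/Probability/RandomPlanarGeometry/ConformalMap.lean`:

* `Literature.JordanDomain.exists_continuousOn_extension_holds : JordanDomain.exists_continuousOn_extension`
  — **Carathéodory's theorem**, disc form (Pommerenke, *Boundary Behaviour of Conformal Maps*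
  (1992), Thm. 2.6, (ii) ⇒ (i) together with `f(𝕋) = ∂G`; Garnett–Marshall, *Harmonic Measure*
  (2005), Thm. I.3.1): a conformal equivalence `φ` of the unit disc `𝔻` onto a Jordan domain `D`
  extends continuously to the closed disc, the extension (`extendFrom 𝔻 φ`) being a bijection of
  the closed disc onto `closure D` which maps the unit circle bijectively onto `∂D`.

* `Literature.JordanDomain.existsUnique_real_or_infty_holds : existsUnique_real_or_infty` — the
  **boundary correspondence in the half-plane form** stated in `ConformalMap.lean`: every point
  of `∂D` is the boundary value of a conformal equivalence `φ : ℍₒ → D` either at exactly one real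
  point or at infinity. This is the one half-plane consequence that needs the *injectivity* half
  of Carathéodory's theorem; it is discharged by combining `exists_continuousOn_extension_holds`
  with the Cayley-transform reduction `JordanDomain.existsUnique_real_or_infty_of_disc` of
  `HalfPlaneAutomorphism.lean` (Pommerenke (1992), Thm. 2.6 via the Cayley transform `𝔻 ≃ ℍₒ`,
  op. cit. §1.2). (The continuity-only consequences `continuousOn_boundaryExtension_holds`,
  `mapsTo_boundaryExtension_holds`, `exists_hasBoundaryValue_holds`,
  `exists_hasBoundaryValueAtInfty_holds` are proved in `CaratheodoryHalfPlaneProofs.lean` from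
  Thm. 2.1 alone.)

(The sibling file `ConformalMapProofs.lean` discharges the elementary `ConformalEquiv` facts; the
present file is kept separate because it needs the much heavier Carathéodory imports.)

The sibling file `CaratheodoryExtension.lean` proves the same conclusion *assuming* the Jordan
curve theorem (`Literature.Topology.PlaneTopology.JordanCurveTheorem`, a named fact), which it uses twice: for the continuity
of the extension and for its injectivity on the circle. `CaratheodoryContinuity.lean` removes the
first use (`Literature.Probability.RandomPlanarGeometry.JordanDomain.continuousOn_extendFrom'`, Pommerenke Thm. 2.1 (ii) ⇒ (i), via the
length–area lemma `Literature.Analysis.Complex.LengthArea.exists_short_crosscut`, Prop. 2.2, and **Janiszewski's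
theorem** `Literature.Topology.PlaneTopology.janiszewski`, §1.1, both proved in `Literature/`). Here we remove the second use
as well, again by Janiszewski's theorem, so that Carathéodory's theorem is proved outright.
Pommerenke's printed proof of injectivity (Prop. 2.5, "no cut points") invokes the Jordan curve
theorem for the curve `f(S) ∪ {a}`, `S` a circular arc in `𝔻`; the argument below replaces that
appeal by Janiszewski's theorem applied to the images of two radii, plus the boundary
uniqueness theorem (`Complex.eqOn_zero_of_diffContOnCl_ball_of_eqOn_arc`,
`Literature/Analysis/Complex/BoundaryUniqueness.lean`), exactly the two ingredients of
Pommerenke's proof of Thm. 2.6. Outline (namespace `Literature.Caratheodory`):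

1. `not_mem_connectedComponentIn` — *two sides of a cut are separated*: if `E ⊆ ℂ` is compact
   with `E ∖ D` preconnected and `S₁, S₂ ⊆ 𝔻` are disjoint open sets containing every point of
   the disc mapped off `E`, then points of `φ (S₁)` and `φ (S₂)` lie in different complementary
   components of `E` (Janiszewski with `A = E`, `B = closedBall 0 R₁ ∖ D`, `A ∩ B = E ∖ D`:
   two such points are joined off `B` inside the connected set `D`; were they also joined off
   `E`, they would be joined off `E ∪ B`, i.e. inside `D ∖ E ⊆ φ (S₁) ⊔ φ (S₂)`).
2. Bookkeeping for `Φ = extendFrom 𝔻 φ` (continuous on the closed disc by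
   `JordanDomain.continuousOn_extendFrom'`): `Φ` maps the closed disc onto `closure D`
   (`surjOn_extendFrom`, compact image containing `D`) and the circle onto `∂D`
   (`extendFrom_mem_frontier`, `surjOn_extendFrom_sphere`); radial limits
   (`tendsto_extendFrom_radial`).
3. `injOn_extendFrom_sphere` — if two points `x ≠ x'` of the circle had the same image `w ∈ ∂D`,
   apply 1. to `E = Φ([0, x]) ∪ Φ([0, x'])` (compact, `E ∖ D = {w}`) and the two open sectors
   `S₁, S₂` of `𝔻` cut out by the two radii: `φ (S₁)` and `φ (S₂)` lie in different
   complementary components of `E`. Every point of `∂D ∖ {w}` is a radial limit through one of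
   the sectors, hence lies in the open union `Oᵢ` of the components met by `φ (Sᵢ)`; `O₁ ∩ O₂ = ∅`
   and `∂D ∖ {w}` (a Jordan curve minus a point) is connected, so it lies in `O₁`, say; then `Φ`
   is constantly `w` on the whole arc of the circle bounding `S₂`, and boundary uniqueness gives
   `φ 0 = w ∈ ∂D`, absurd (`false_of_eq_on_arc`). With injectivity inside the disc and
   `Φ(𝔻) = D ∌ Φ(𝕋) ⊆ ∂D` this gives `InjOn Φ (closedBall 0 1)` (`injOn_extendFrom`) and the theorem.

## References

* Ch. Pommerenke, *Boundary Behaviour of Conformal Maps*, Grundlehren 299, Springer (1992),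
  §1.1 (Janiszewski's theorem), Thm. 2.1, Prop. 2.2, Prop. 2.5, Thm. 2.6 (Carathéodory's theorem).
* J. B. Garnett, D. E. Marshall, *Harmonic Measure*, CUP (2005), Lemma I.3.2, Thm. I.3.1.
-/

noncomputable section

open Set Filter Metric Topology Complex Real

namespace Literature.Probability.RandomPlanarGeometry

namespace Caratheodory

variable {D : JordanDomain} (φ : ConformalEquiv (ball (0 : ℂ) 1) D.carrier)

/-- Images of open subsets of the disc under a conformal equivalence `φ : 𝔻 → D` are open (the
inverse is continuous on the open set `D`). [folklore] -/
theorem isOpen_image {s : Set ℂ} (hs : IsOpen s) (hsub : s ⊆ ball 0 1) : IsOpen (φ '' s) := by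
  have heq : φ '' s = D.carrier ∩ φ.symm ⁻¹' s := by
    ext y
    constructor
    · rintro ⟨x, hx, rfl⟩
      refine ⟨φ.mapsTo (hsub hx), ?_⟩
      rw [mem_preimage, φ.symm_apply_apply (hsub hx)]
      exact hx
    · rintro ⟨hy, hys⟩
      exact ⟨φ.symm y, hys, φ.apply_symm_apply hy⟩
  rw [heq]
  exact φ.symm.continuousOn.isOpen_inter_preimage D.isOpen hs


/-- **Two sides of a cut are separated** (Janiszewski). Let `E ⊆ ℂ` be compact with `E ∖ D`
preconnected, and let `S₁, S₂ ⊆ 𝔻` be disjoint open sets containing every point of the disc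
whose image is off `E`. Then no point of `φ (S₂)` lies in the complementary component of `E`
of a point of `φ (S₁)`. Proof: with `B = closedBall 0 R₁ ∖ D` (compact, `E ∩ B = E ∖ D`
preconnected), two such points are joined off `B` (inside the connected `D`); were they joined
off `E`, Janiszewski's theorem would join them off `E ∪ B`, i.e. inside `D ∖ E ⊆ φ (S₁) ⊔ φ (S₂)`
(up to a far-away open set), two disjoint open sets — impossible for a connected set meeting
both. Pommerenke (1992), proof of Thm. 2.1 (iv) ⇒ (i). [cite: PommerenkeBBCM1992, Thm. 2.1 (proof, (iv) ⇒ (i))] -/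
theorem not_mem_connectedComponentIn {E : Set ℂ} (hE : IsCompact E)
    (hEG : IsPreconnected (E \ D.carrier)) {S₁ S₂ : Set ℂ} (hS₁ : IsOpen S₁) (hS₂ : IsOpen S₂)
    (hS₁b : S₁ ⊆ ball 0 1) (hS₂b : S₂ ⊆ ball 0 1) (hdisj : Disjoint S₁ S₂)
    (hcover : ∀ x ∈ ball (0 : ℂ) 1, φ x ∉ E → x ∈ S₁ ∪ S₂)
    {x₁ x₂ : ℂ} (hx₁ : x₁ ∈ S₁) (hx₂ : x₂ ∈ S₂) :
    φ x₂ ∉ connectedComponentIn Eᶜ (φ x₁) := by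
  intro hsame
  obtain ⟨R₀, hR₀⟩ := (hE.isBounded.union D.isBounded).subset_closedBall 0
  set R₁ : ℝ := R₀ + 1 with hR₁
  set B : Set ℂ := closedBall 0 R₁ \ D.carrier with hB
  have hBc : IsCompact B := (isCompact_closedBall 0 R₁).diff D.isOpen
  have hGsub : D.carrier ⊆ closedBall 0 R₀ := subset_union_right.trans hR₀
  have hEsub : E ⊆ closedBall 0 R₀ := subset_union_left.trans hR₀
  have hEB : E ∩ B = E \ D.carrier := by
    apply Subset.antisymm
    · rintro z ⟨hzE, -, hzG⟩; exact ⟨hzE, hzG⟩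
    · rintro z ⟨hzE, hzG⟩
      exact ⟨hzE, closedBall_subset_closedBall (by linarith) (hEsub hzE), hzG⟩
  have hEBc : IsPreconnected (E ∩ B) := hEB ▸ hEG
  have hGB : D.carrier ⊆ Bᶜ := fun z hz hzB ↦ hzB.2 hz
  have hyB : φ x₂ ∈ connectedComponentIn Bᶜ (φ x₁) :=
    D.isConnected.isPreconnected.subset_connectedComponentIn (φ.mapsTo (hS₁b hx₁)) hGB
      (φ.mapsTo (hS₂b hx₂))
  have hW := Literature.Topology.PlaneTopology.janiszewski hE hBc hEBc hsame hyB
  set W := connectedComponentIn (E ∪ B)ᶜ (φ x₁) with hWdef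
  have hWc : IsPreconnected W := isPreconnected_connectedComponentIn
  set U : Set ℂ := φ '' S₁ with hU
  set V : Set ℂ := φ '' S₂ ∪ (closedBall 0 R₁)ᶜ with hV
  have hUo : IsOpen U := isOpen_image φ hS₁ hS₁b
  have hVo : IsOpen V := (isOpen_image φ hS₂ hS₂b).union isClosed_closedBall.isOpen_compl
  have hUV : Disjoint U V := by
    rw [Set.disjoint_left]
    rintro _ ⟨a₁, ha₁, rfl⟩ (⟨a₂, ha₂, heq⟩ | hfar)
    · have := φ.injOn (hS₂b ha₂) (hS₁b ha₁) heq
      subst this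
      exact Set.disjoint_left.1 hdisj ha₁ ha₂
    · exact hfar (closedBall_subset_closedBall (by linarith) (hGsub (φ.mapsTo (hS₁b ha₁))))
  have hWUV : W ⊆ U ∪ V := by
    intro z hz
    have hz' : z ∈ (E ∪ B)ᶜ := connectedComponentIn_subset _ _ hz
    rw [compl_union] at hz'
    obtain ⟨hzE, hzB⟩ := hz'
    by_cases hzR : z ∈ closedBall (0 : ℂ) R₁
    · have hzG : z ∈ D.carrier := by
        by_contra h
        exact hzB ⟨hzR, h⟩
      have hz'' : z ∈ φ '' ball 0 1 := by rw [JordanDomain.image_ball_eq]; exact hzG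
      obtain ⟨x₀, hx₀, rfl⟩ := hz''
      rcases hcover x₀ hx₀ hzE with h | h
      · exact Or.inl ⟨x₀, h, rfl⟩
      · exact Or.inr (Or.inl ⟨x₀, h, rfl⟩)
    · exact Or.inr (Or.inr hzR)
  have hxF : φ x₁ ∈ (E ∪ B)ᶜ := connectedComponentIn_nonempty_iff.1 ⟨_, hW⟩
  have hxW : φ x₁ ∈ W := mem_connectedComponentIn hxF
  have hxU : φ x₁ ∈ U := ⟨x₁, hx₁, rfl⟩
  have hWU : W ⊆ U := hWc.subset_left_of_subset_union hUo hVo hUV hWUV ⟨_, hxW, hxU⟩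
  have hyV : φ x₂ ∈ V := Or.inl ⟨x₂, hx₂, rfl⟩
  exact Set.disjoint_left.1 hUV (hWU hW) hyV


/-- The extension is the limit of `φ` at every point of the closed disc. [folklore] -/
theorem tendsto_extendFrom {x : ℂ} (hx : x ∈ closedBall (0 : ℂ) 1) :
    Tendsto φ (𝓝[ball 0 1] x) (𝓝 (extendFrom (ball 0 1) φ x)) :=
  _root_.tendsto_extendFrom (JordanDomain.exists_tendsto_of_mem_closedBall' φ hx)

/-- The extension maps the closed disc into `closure D`. [folklore] -/
theorem extendFrom_mem_closure {x : ℂ} (hx : x ∈ closedBall (0 : ℂ) 1) :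
    extendFrom (ball 0 1) φ x ∈ closure D.carrier := by
  haveI := JordanDomain.neBot_nhdsWithin_ball hx
  exact mem_closure_of_tendsto (tendsto_extendFrom φ hx)
    (eventually_mem_nhdsWithin.mono fun z hz ↦ φ.mapsTo hz)

/-- The extension maps the unit circle into `∂D`. [folklore] -/
theorem extendFrom_mem_frontier {x : ℂ} (hx : ‖x‖ = 1) :
    extendFrom (ball 0 1) φ x ∈ frontier D.carrier := by
  have hx' : x ∈ closedBall (0 : ℂ) 1 := mem_closedBall_zero_iff.2 hx.le
  haveI := JordanDomain.neBot_nhdsWithin_ball hx'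
  exact JordanDomain.mem_frontier_of_tendsto φ (l := 𝓝[ball (0 : ℂ) 1] x) (g := id)
    eventually_mem_nhdsWithin hx (tendsto_id.mono_left nhdsWithin_le_nhds)
    (tendsto_extendFrom φ hx')

/-- The extension maps the closed disc onto `closure D`. [folklore] -/
theorem surjOn_extendFrom :
    SurjOn (extendFrom (ball 0 1) φ) (closedBall (0 : ℂ) 1) (closure D.carrier) := by
  have hK : IsCompact (extendFrom (ball 0 1) φ '' closedBall (0 : ℂ) 1) :=
    (isCompact_closedBall 0 1).image_of_continuousOn (JordanDomain.continuousOn_extendFrom' φ)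
  have hΩ : D.carrier ⊆ extendFrom (ball 0 1) φ '' closedBall (0 : ℂ) 1 := by
    intro y hy
    have hy' : y ∈ φ '' ball 0 1 := by rw [JordanDomain.image_ball_eq φ]; exact hy
    obtain ⟨x, hx, rfl⟩ := hy'
    exact ⟨x, ball_subset_closedBall hx, JordanDomain.extendFrom_eq φ hx⟩
  exact hK.isClosed.closure_subset_iff.2 hΩ

/-- The extension maps the unit circle onto `∂D`. [folklore] -/
theorem surjOn_extendFrom_sphere :
    SurjOn (extendFrom (ball 0 1) φ) (sphere (0 : ℂ) 1) (frontier D.carrier) := by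
  intro y hy
  obtain ⟨x, hx, rfl⟩ := surjOn_extendFrom φ (frontier_subset_closure hy)
  rcases eq_or_lt_of_le (mem_closedBall_zero_iff.1 hx) with h | h
  · exact ⟨x, mem_sphere_zero_iff_norm.2 h, rfl⟩
  · exfalso
    rw [JordanDomain.extendFrom_eq φ (mem_ball_zero_iff.2 h)] at hy
    exact D.not_mem_of_mem_frontier hy (φ.mapsTo (mem_ball_zero_iff.2 h))

/-- Radial limits of the extension: `Φ (ρ e) → Φ e` as `ρ → 1⁻` (`‖e‖ = 1`). [folklore] -/
theorem tendsto_extendFrom_radial {e : ℂ} (he : ‖e‖ = 1) :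
    Tendsto (fun ρ : ℝ ↦ extendFrom (ball 0 1) φ ((ρ : ℂ) * e)) (𝓝[<] 1)
      (𝓝 (extendFrom (ball 0 1) φ e)) := by
  have hcont := (JordanDomain.continuousOn_extendFrom' φ) e (mem_closedBall_zero_iff.2 he.le)
  have hpath : Tendsto (fun ρ : ℝ ↦ (ρ : ℂ) * e) (𝓝[<] 1) (𝓝[closedBall (0 : ℂ) 1] e) := by
    refine tendsto_nhdsWithin_iff.2 ⟨?_, ?_⟩
    · have : Tendsto (fun ρ : ℝ ↦ (ρ : ℂ) * e) (𝓝 1) (𝓝 ((1 : ℝ) * e)) :=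
        ((continuous_ofReal.tendsto 1).mul tendsto_const_nhds)
      rw [ofReal_one, one_mul] at this
      exact this.mono_left nhdsWithin_le_nhds
    · filter_upwards [Ioo_mem_nhdsLT one_pos] with ρ hρ
      rw [mem_closedBall_zero_iff, norm_mul, he, mul_one, Complex.norm_real, Real.norm_eq_abs,
        abs_of_pos hρ.1]
      exact hρ.2.le
  exact hcont.tendsto.comp hpath

/-! ### Injectivity of the extension on the circle, by Janiszewski's theorem -/

/-- Sectors `{ρ e^{it} : 0 < ρ < 1, θa < t < θb}` of angular width at most `2π` are open
(polar coordinates about the bisecting ray are a homeomorphism onto the slit plane). [folklore] -/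
theorem isOpen_sector {θa θb : ℝ} (h : θb - θa ≤ 2 * π) : IsOpen (sector θa θb) := by
  set θm : ℝ := (θa + θb) / 2 with hθm
  set η : ℝ := (θb - θa) / 2 with hη
  have hηπ : η ≤ π := by rw [hη]; linarith
  set T : Set (ℝ × ℝ) := Ioo (0 : ℝ) 1 ×ˢ Ioo (-η) η with hT
  have hTo : IsOpen T := isOpen_Ioo.prod isOpen_Ioo
  have hTt : T ⊆ Complex.polarCoord.target := by
    rw [Complex.polarCoord_target]
    exact prod_mono (fun ρ hρ ↦ hρ.1) (Ioo_subset_Ioo (by linarith) (by linarith))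
  have hopen : IsOpen (Complex.polarCoord.symm '' T) :=
    Complex.polarCoord.isOpen_image_symm_of_subset_target hTo hTt
  have hrot : IsOpen ((fun z : ℂ ↦ exp (θm * I) * z) '' (Complex.polarCoord.symm '' T)) :=
    (Homeomorph.mulLeft₀ (exp (θm * I)) (exp_ne_zero _)).isOpenMap _ hopen
  have heq : sector θa θb = (fun z : ℂ ↦ exp (θm * I) * z) '' (Complex.polarCoord.symm '' T) := by
    rw [image_image]
    ext z
    simp only [sector, hT, mem_image, mem_prod, mem_Ioo, Prod.exists, Literature.Analysis.Complex.LengthArea.polarCoord_symm_eq]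
    constructor
    · rintro ⟨ρ, t, ⟨hρ, ht⟩, rfl⟩
      refine ⟨ρ, t - θm, ⟨hρ, by rw [hη, hθm]; linarith [ht.1], by rw [hη, hθm]; linarith [ht.2]⟩,
        ?_⟩
      rw [← mul_assoc, mul_comm (Complex.exp _) (ρ : ℂ), mul_assoc, ← Complex.exp_add]
      congr 2
      push_cast
      ring
    · rintro ⟨ρ, t, ⟨hρ, ht⟩, rfl⟩
      refine ⟨ρ, t + θm, ⟨hρ, by linarith [ht.1], by linarith [ht.2]⟩, ?_⟩
      rw [← mul_assoc, mul_comm (Complex.exp _) (ρ : ℂ), mul_assoc, ← Complex.exp_add]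
      congr 2
      push_cast
      ring
  rw [heq]
  exact hrot

/-- The two sectors `(θ₁, θ₂)` and `(θ₂, θ₁ + 2π)` are disjoint. [folklore] -/
theorem disjoint_sector (θ₁ θ₂ : ℝ) :
    Disjoint (sector θ₁ θ₂) (sector θ₂ (θ₁ + 2 * π)) := by
  rw [Set.disjoint_left]
  rintro z ⟨⟨ρ, t⟩, ⟨hρ, ht⟩, rfl⟩ ⟨⟨ρ', t'⟩, ⟨hρ', ht'⟩, heq⟩
  simp only [mem_Ioo] at heq ht ht' hρ hρ'
  have hn : ρ' = ρ := by
    have := congrArg norm heq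
    simpa [norm_exp_ofReal_mul_I, abs_of_pos hρ.1, abs_of_pos hρ'.1] using this
  subst hn
  have h1 := mul_left_cancel₀ (ofReal_ne_zero.2 hρ'.1.ne') heq
  have hlt : |t' - t| < 2 * π := by
    rw [abs_sub_lt_iff]; constructor <;> linarith [ht.1, ht.2, ht'.1, ht'.2]
  have := eq_of_exp_mul_I_eq h1 hlt
  linarith [ht.2, ht'.1]

/-- A point of the unit circle other than `exp (θ₁ i)`, `exp (θ₂ i)` is `exp (t i)` with `t` in
one of the two open arcs `(θ₁, θ₂)`, `(θ₂, θ₁ + 2π)`. [folklore] -/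
theorem exists_angle_mem_Ioo_or {θ₁ θ₂ : ℝ} {e : ℂ} (he : ‖e‖ = 1) (h1 : e ≠ exp (θ₁ * I))
    (h2 : e ≠ exp (θ₂ * I)) :
    ∃ t : ℝ, e = exp (t * I) ∧ (t ∈ Ioo θ₁ θ₂ ∨ t ∈ Ioo θ₂ (θ₁ + 2 * π)) := by
  set t := toIocMod Real.two_pi_pos θ₁ (arg e) with ht
  have het : e = exp (t * I) := by
    have := eq_norm_mul_exp_toIocMod θ₁ e
    rwa [he, ofReal_one, one_mul] at this
  have hmem := toIocMod_mem_Ioc Real.two_pi_pos θ₁ (arg e)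
  have ht1 : t ≠ θ₁ + 2 * π := fun h ↦ h1 (by
    rw [het, h, ofReal_add, add_mul, Complex.exp_add]
    push_cast
    rw [show (2 : ℂ) * π * I = (1 : ℤ) * (2 * π * I) by simp, exp_int_mul_two_pi_mul_I, mul_one])
  have ht2 : t ≠ θ₂ := fun h ↦ h2 (by rw [het, h])
  refine ⟨t, het, ?_⟩
  rcases lt_or_gt_of_ne ht2 with h | h
  · exact Or.inl ⟨hmem.1, h⟩
  · exact Or.inr ⟨h, lt_of_le_of_ne hmem.2 ht1⟩

/-- **Boundary uniqueness endgame.** The extension cannot be constant `= w ∉ D` on an arc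
`{exp (t i) : θa < t < θb}` of the unit circle: by the boundary uniqueness theorem
(`Complex.eqOn_zero_of_diffContOnCl_ball_of_eqOn_arc`) `Φ - w` would vanish on the closed disc,
giving `φ 0 = w`. [folklore] -/
theorem false_of_eq_on_arc {θa θb : ℝ} (hab : θa < θb) {w : ℂ} (hwΩ : w ∉ D.carrier)
    (harc : ∀ t ∈ Ioo θa θb, extendFrom (ball 0 1) φ (exp (t * I)) = w) : False := by
  obtain ⟨U, hUo, hUne, hUarc⟩ := exists_isOpen_arc hab
  have hdc : DiffContOnCl ℂ (fun z ↦ extendFrom (ball 0 1) φ z - w) (ball (0 : ℂ) 1) := by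
    refine DiffContOnCl.sub ⟨?_, ?_⟩ diffContOnCl_const
    · exact φ.differentiableOn.congr fun z hz ↦ JordanDomain.extendFrom_eq φ hz
    · rw [closure_ball 0 one_ne_zero]; exact JordanDomain.continuousOn_extendFrom' φ
  have hzero := Complex.eqOn_zero_of_diffContOnCl_ball_of_eqOn_arc hdc hUo hUne (fun z hz ↦ by
    obtain ⟨t, ht, rfl⟩ := hUarc z hz
    simp only [harc t ht, sub_self])
  have h0 : extendFrom (ball 0 1) φ 0 - w = 0 := hzero (mem_closedBall_self zero_le_one)
  rw [JordanDomain.extendFrom_eq φ (mem_ball_self one_pos), sub_eq_zero] at h0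
  exact hwΩ (h0 ▸ φ.mapsTo (mem_ball_self one_pos))

/-- **Carathéodory extension, injectivity on the circle** (no Jordan curve theorem). Two distinct
points `x, x'` of the unit circle have distinct images. Otherwise, with `w ∈ ∂D` the common image,
let `E ⊆ D ∪ {w}` be the union of the images of the two radii (a compact set with
`E ∖ D = {w}`) and `S₁, S₂` the two open sectors of the disc they bound. By Janiszewski's
theorem (`not_mem_connectedComponentIn`) points of `φ (S₁)` and of `φ (S₂)` lie in different
complementary components of `E`. Every point of `∂D ∖ {w}` is a radial limit through one of the
sectors, hence lies in the open set `Oᵢ` of components met by `φ (Sᵢ)`; `O₁, O₂` are disjoint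
and `∂D ∖ {w}` (a Jordan curve minus a point) is connected, so it lies in one of them, say `O₁`;
then the extension is constantly `w` on the arc of the circle bounding `S₂`, and the boundary
uniqueness theorem gives `φ 0 = w`, absurd. Pommerenke (1992), Prop. 2.5 and Thm. 2.6. [cite: PommerenkeBBCM1992, Thm. 2.6] -/
theorem injOn_extendFrom_sphere : InjOn (extendFrom (ball 0 1) φ) (sphere (0 : ℂ) 1) := by
  set Φ := extendFrom (ball 0 1) φ with hΦ
  intro x hx x' hx' hw
  by_contra hne
  have hx1 : ‖x‖ = 1 := mem_sphere_zero_iff_norm.1 hx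
  have hx1' : ‖x'‖ = 1 := mem_sphere_zero_iff_norm.1 hx'
  set w := Φ x with hwdef
  have hwJ : w ∈ frontier D.carrier := extendFrom_mem_frontier φ hx1
  have hΦc := JordanDomain.continuousOn_extendFrom' φ
  obtain ⟨θ₁, θ₂, hxθ, hx'θ, h12, h21⟩ := exists_angles hx1 hx1' hne
  -- membership of radial points
  have hrad : ∀ {e : ℂ}, ‖e‖ = 1 → ∀ s ∈ Ico (0 : ℝ) 1, (s : ℂ) * e ∈ ball (0 : ℂ) 1 := by
    intro e he s hs
    rw [mem_ball_zero_iff, norm_mul, he, mul_one, Complex.norm_real, Real.norm_eq_abs,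
      abs_of_nonneg hs.1]
    exact hs.2
  have hrad' : ∀ {e : ℂ}, ‖e‖ = 1 → ∀ s ∈ Icc (0 : ℝ) 1, (s : ℂ) * e ∈ closedBall (0 : ℂ) 1 := by
    intro e he s hs
    rw [mem_closedBall_zero_iff, norm_mul, he, mul_one, Complex.norm_real, Real.norm_eq_abs,
      abs_of_nonneg hs.1]
    exact hs.2
  -- the two radii `p` (from `φ 0` to `w` along `x`) and `q` (from `w` to `φ 0` along `x'`)
  set p : ℝ → ℂ := fun s ↦ Φ ((s : ℂ) * x) with hp
  set q : ℝ → ℂ := fun s ↦ Φ (((1 - s : ℝ) : ℂ) * x') with hq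
  have hpc : ContinuousOn p (Icc 0 1) := hΦc.comp (by fun_prop) (hrad' hx1)
  have hqc : ContinuousOn q (Icc 0 1) :=
    hΦc.comp (by fun_prop) fun s hs ↦ hrad' hx1' (1 - s) ⟨by linarith [hs.2], by linarith [hs.1]⟩
  have hp_lt : ∀ s ∈ Ico (0 : ℝ) 1, p s = φ ((s : ℂ) * x) := fun s hs ↦
    JordanDomain.extendFrom_eq φ (hrad hx1 s hs)
  have hq_gt : ∀ s ∈ Ioc (0 : ℝ) 1, q s = φ (((1 - s : ℝ) : ℂ) * x') := fun s hs ↦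
    JordanDomain.extendFrom_eq φ (hrad hx1' (1 - s) ⟨by linarith [hs.2], by linarith [hs.1]⟩)
  have hp1 : p 1 = w := by simp [hp, hwdef]
  have hq0 : q 0 = w := by simp only [hq, sub_zero, ofReal_one, one_mul]; exact hw.symm
  have hp0 : p 0 = φ 0 := by
    simp only [hp, ofReal_zero, zero_mul]
    exact JordanDomain.extendFrom_eq φ (mem_ball_self one_pos)
  have hpΩ : ∀ s ∈ Ico (0 : ℝ) 1, p s ∈ D.carrier := fun s hs ↦ by
    rw [hp_lt s hs]; exact φ.mapsTo (hrad hx1 s hs)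
  have hqΩ : ∀ s ∈ Ioc (0 : ℝ) 1, q s ∈ D.carrier := fun s hs ↦ by
    rw [hq_gt s hs]; exact φ.mapsTo (hrad hx1' (1 - s) ⟨by linarith [hs.2], by linarith [hs.1]⟩)
  have hwΩ : w ∉ D.carrier := D.not_mem_of_mem_frontier hwJ
  -- the compact set `E = p [0,1] ∪ q [0,1] ⊆ D ∪ {w}`
  set E := p '' Icc 0 1 ∪ q '' Icc 0 1 with hE
  have hEsub : E ⊆ D.carrier ∪ {w} := by
    rintro z (⟨s, hs, rfl⟩ | ⟨s, hs, rfl⟩)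
    · rcases eq_or_lt_of_le hs.2 with rfl | hs1
      · exact Or.inr hp1
      · exact Or.inl (hpΩ s ⟨hs.1, hs1⟩)
    · rcases eq_or_lt_of_le hs.1 with h0 | hs0
      · exact Or.inr (by rw [← h0]; exact hq0)
      · exact Or.inl (hqΩ s ⟨hs0, hs.2⟩)
  have hEc : IsCompact E :=
    (isCompact_Icc.image_of_continuousOn hpc).union (isCompact_Icc.image_of_continuousOn hqc)
  have hEo : IsOpen Eᶜ := hEc.isClosed.isOpen_compl
  have hEG : IsPreconnected (E \ D.carrier) := by
    refine Set.Subsingleton.isPreconnected ?_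
    rintro z ⟨hz, hzG⟩ z' ⟨hz', hz'G⟩
    have h1 := (hEsub hz).resolve_left hzG
    have h2 := (hEsub hz').resolve_left hz'G
    rw [mem_singleton_iff] at h1 h2
    rw [h1, h2]
  -- the two sectors
  set S₁ := sector θ₁ θ₂ with hS₁
  set S₂ := sector θ₂ (θ₁ + 2 * π) with hS₂
  have hS₁o : IsOpen S₁ := isOpen_sector (by linarith)
  have hS₂o : IsOpen S₂ := isOpen_sector (by linarith)
  have hS₁₂ : Disjoint S₁ S₂ := disjoint_sector θ₁ θ₂
  have hcover : ∀ z ∈ ball (0 : ℂ) 1, φ z ∉ E → z ∈ S₁ ∪ S₂ := by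
    intro z hz hzE
    have hz0 : z ≠ 0 := by
      rintro rfl
      exact hzE (Or.inl ⟨0, ⟨le_rfl, zero_le_one⟩, hp0⟩)
    have hzn : ‖z‖ ∈ Ioo (0 : ℝ) 1 := ⟨norm_pos_iff.2 hz0, mem_ball_zero_iff.1 hz⟩
    have h1 : z ≠ (‖z‖ : ℂ) * exp (θ₁ * I) := fun heq ↦ hzE (Or.inl ⟨‖z‖, ⟨hzn.1.le, hzn.2.le⟩, by
      rw [hp_lt _ ⟨hzn.1.le, hzn.2⟩, hxθ, ← heq]⟩)
    have h2 : z ≠ (‖z‖ : ℂ) * exp (θ₂ * I) := fun heq ↦ hzE (Or.inr ⟨1 - ‖z‖,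
      ⟨by linarith [hzn.2], by linarith [hzn.1]⟩, by
        rw [hq_gt _ ⟨by linarith [hzn.2], by linarith [hzn.1]⟩, hx'θ, sub_sub_cancel, ← heq]⟩)
    exact mem_sector_or hz hz0 h1 h2
  -- Janiszewski: the two sectors are mapped into different complementary components of `E`
  have hsep : ∀ z₁ ∈ S₁, ∀ z₂ ∈ S₂, φ z₂ ∉ connectedComponentIn Eᶜ (φ z₁) :=
    fun z₁ hz₁ z₂ hz₂ ↦ not_mem_connectedComponentIn φ hEc hEG hS₁o hS₂o sector_subset_ball
      sector_subset_ball hS₁₂ hcover hz₁ hz₂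
  -- the open sets of components met by the two sectors
  set O₁ : Set ℂ := ⋃ z ∈ S₁, connectedComponentIn Eᶜ (φ z) with hO₁
  set O₂ : Set ℂ := ⋃ z ∈ S₂, connectedComponentIn Eᶜ (φ z) with hO₂
  have hO₁o : IsOpen O₁ := isOpen_biUnion fun z _ ↦ hEo.connectedComponentIn
  have hO₂o : IsOpen O₂ := isOpen_biUnion fun z _ ↦ hEo.connectedComponentIn
  have hO₁₂ : Disjoint O₁ O₂ := by
    rw [Set.disjoint_left]
    intro y hy₁ hy₂
    obtain ⟨z₁, hz₁, hy₁⟩ := mem_iUnion₂.1 hy₁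
    obtain ⟨z₂, hz₂, hy₂⟩ := mem_iUnion₂.1 hy₂
    refine hsep z₁ hz₁ z₂ hz₂ ?_
    rw [connectedComponentIn_eq hy₁, ← connectedComponentIn_eq hy₂]
    exact mem_connectedComponentIn (connectedComponentIn_nonempty_iff.1 ⟨y, hy₂⟩)
  -- radial limits: a boundary point `Φ (e^{it}) ≠ w` with `t` in the arc of `S` lies in `O(S)`
  have hradial : ∀ (S : Set ℂ) (t : ℝ), (∀ ρ ∈ Ioo (0 : ℝ) 1, (ρ : ℂ) * exp (t * I) ∈ S) →
      S ⊆ ball 0 1 → Φ (exp (t * I)) ≠ w →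
      Φ (exp (t * I)) ∈ ⋃ z ∈ S, connectedComponentIn Eᶜ (φ z) := by
    intro S t hS hSb hne'
    have he : ‖exp (t * I)‖ = 1 := norm_exp_ofReal_mul_I t
    have hyJ : Φ (exp (t * I)) ∈ frontier D.carrier := extendFrom_mem_frontier φ he
    have hyE : Φ (exp (t * I)) ∉ E := fun h ↦
      (hEsub h).elim (D.not_mem_of_mem_frontier hyJ) (fun h' ↦ hne' h')
    obtain ⟨ε, hε, hball⟩ := Metric.isOpen_iff.1 hEo _ hyE
    have hlim := tendsto_extendFrom_radial φ he
    have hev : ∀ᶠ ρ : ℝ in 𝓝[<] 1, Φ ((ρ : ℂ) * exp (t * I)) ∈ ball (Φ (exp (t * I))) ε :=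
      hlim (ball_mem_nhds _ hε)
    obtain ⟨ρ, hρy, hρ⟩ := (hev.and (Ioo_mem_nhdsLT one_pos)).exists
    have hmemS : (ρ : ℂ) * exp (t * I) ∈ S := hS ρ hρ
    have hΦρ : Φ ((ρ : ℂ) * exp (t * I)) = φ ((ρ : ℂ) * exp (t * I)) :=
      JordanDomain.extendFrom_eq φ (hSb hmemS)
    refine mem_iUnion₂.2 ⟨_, hmemS, ?_⟩
    rw [← hΦρ]
    exact (convex_ball _ ε).isPreconnected.subset_connectedComponentIn hρy hball
      (mem_ball_self hε)
  -- `∂D ∖ {w}` is connected and covered by `O₁ ∪ O₂`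
  set J' : Set ℂ := frontier D.carrier \ {w} with hJ'
  have hJ'c : IsPreconnected J' := by
    obtain ⟨s₀, hs₀⟩ : w ∈ range D.boundary := by rw [D.range_boundary]; exact hwJ
    have heq : J' = D.boundary '' Ioo s₀ (s₀ + 1) := by
      ext y
      constructor
      · rintro ⟨hyJ, hyw⟩
        rw [← D.range_boundary] at hyJ
        obtain ⟨s, rfl⟩ := hyJ
        obtain ⟨s', hs', hss'⟩ := D.periodic_boundary.exists_mem_Ico one_pos s s₀
        refine ⟨s', ⟨lt_of_le_of_ne hs'.1 ?_, hs'.2⟩, hss'.symm⟩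
        rintro rfl
        exact hyw (by rw [mem_singleton_iff, hss', hs₀])
      · rintro ⟨s, hs, rfl⟩
        refine ⟨D.boundary_mem_frontier s, fun h ↦ ?_⟩
        rw [mem_singleton_iff, ← hs₀] at h
        have := D.injOn_boundary_Ico s₀ ⟨hs.1.le, hs.2⟩ ⟨le_rfl, by linarith⟩ h
        linarith [hs.1]
    rw [heq]
    exact isPreconnected_Ioo.image _ D.continuous_boundary.continuousOn
  have hJ'sub : J' ⊆ O₁ ∪ O₂ := by
    rintro y ⟨hyJ, hyw⟩
    obtain ⟨e, he, rfl⟩ := surjOn_extendFrom_sphere φ hyJ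
    have he1 : ‖e‖ = 1 := mem_sphere_zero_iff_norm.1 he
    have h1 : e ≠ exp (θ₁ * I) := fun h ↦ hyw (by rw [mem_singleton_iff, h, ← hxθ])
    have h2 : e ≠ exp (θ₂ * I) := fun h ↦ hyw (by rw [mem_singleton_iff, h, ← hx'θ]; exact hw.symm)
    obtain ⟨t, rfl, ht⟩ := exists_angle_mem_Ioo_or he1 h1 h2
    rcases ht with ht | ht
    · exact Or.inl (hradial S₁ t (fun ρ hρ ↦ ⟨(ρ, t), ⟨hρ, ht⟩, rfl⟩) sector_subset_ball hyw)
    · exact Or.inr (hradial S₂ t (fun ρ hρ ↦ ⟨(ρ, t), ⟨hρ, ht⟩, rfl⟩) sector_subset_ball hyw)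
  -- hence in one of them: the extension is constantly `w` on the other arc
  rcases hJ'c.subset_or_subset hO₁o hO₂o hO₁₂ hJ'sub with hJ'O | hJ'O
  · refine false_of_eq_on_arc φ h21 hwΩ fun t ht ↦ ?_
    by_contra hne'
    have hmem₂ := hradial S₂ t (fun ρ hρ ↦ ⟨(ρ, t), ⟨hρ, ht⟩, rfl⟩) sector_subset_ball hne'
    have hyJ' : Φ (exp (t * I)) ∈ J' :=
      ⟨extendFrom_mem_frontier φ (norm_exp_ofReal_mul_I t), hne'⟩
    exact Set.disjoint_left.1 hO₁₂ (hJ'O hyJ') hmem₂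
  · refine false_of_eq_on_arc φ h12 hwΩ fun t ht ↦ ?_
    by_contra hne'
    have hmem₁ := hradial S₁ t (fun ρ hρ ↦ ⟨(ρ, t), ⟨hρ, ht⟩, rfl⟩) sector_subset_ball hne'
    have hyJ' : Φ (exp (t * I)) ∈ J' :=
      ⟨extendFrom_mem_frontier φ (norm_exp_ofReal_mul_I t), hne'⟩
    exact Set.disjoint_left.1 hO₁₂ hmem₁ (hJ'O hyJ')

/-- **Carathéodory extension, injectivity on the closed disc** (Pommerenke (1992), Thm. 2.6,
injectivity part; no Jordan curve theorem). [cite: PommerenkeBBCM1992, Thm. 2.6] -/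
theorem injOn_extendFrom : InjOn (extendFrom (ball 0 1) φ) (closedBall (0 : ℂ) 1) := by
  intro x hx x' hx' h
  have key : ∀ y ∈ ball (0 : ℂ) 1, ∀ y', ‖y'‖ = 1 →
      extendFrom (ball 0 1) φ y ≠ extendFrom (ball 0 1) φ y' := by
    intro y hy y' hy' heq
    rw [JordanDomain.extendFrom_eq φ hy] at heq
    exact D.not_mem_of_mem_frontier (heq ▸ extendFrom_mem_frontier φ hy') (φ.mapsTo hy)
  rcases eq_or_lt_of_le (mem_closedBall_zero_iff.1 hx) with h1 | h1 <;>
    rcases eq_or_lt_of_le (mem_closedBall_zero_iff.1 hx') with h1' | h1'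
  · exact injOn_extendFrom_sphere φ (mem_sphere_zero_iff_norm.2 h1)
      (mem_sphere_zero_iff_norm.2 h1') h
  · exact absurd h.symm (key x' (mem_ball_zero_iff.2 h1') x h1)
  · exact absurd h (key x (mem_ball_zero_iff.2 h1) x' h1')
  · rw [JordanDomain.extendFrom_eq φ (mem_ball_zero_iff.2 h1),
      JordanDomain.extendFrom_eq φ (mem_ball_zero_iff.2 h1')] at h
    exact φ.injOn (mem_ball_zero_iff.2 h1) (mem_ball_zero_iff.2 h1') h

end Caratheodory

/-! ### Carathéodory's theorem -/

namespace JordanDomain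

/-- **Carathéodory's theorem for Jordan domains** (`exists_continuousOn_extension` holds):
every conformal equivalence `φ` of the unit disc onto a Jordan domain `D` extends continuously
to the closed disc, the extension (`extendFrom 𝔻 φ`) being a bijection of the closed disc onto
`closure D` which maps the unit circle bijectively onto `∂D`. Pommerenke, *Boundary Behaviour of
Conformal Maps* (1992), Thm. 2.6 ((ii) ⇒ (i), with `f(𝕋) = ∂G`); Garnett–Marshall, *Harmonic
Measure* (2005), Thm. I.3.1. The proof follows the printed one: the length–area lemma
(Prop. 2.2, `Literature.Analysis.Complex.LengthArea.exists_short_crosscut`) and Janiszewski's theorem (§1.1,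
`Literature.Topology.PlaneTopology.janiszewski`) give continuity (Thm. 2.1, `JordanDomain.continuousOn_extendFrom'`);
Janiszewski's theorem again separates the two sectors cut out by two radii with a common
endpoint image, and the boundary uniqueness theorem gives injectivity (Prop. 2.5, Thm. 2.6,
`Caratheodory.injOn_extendFrom`). Unlike `exists_continuousOn_extension_of_jordanCurveTheorem`,
no Jordan curve theorem is assumed. [cite: PommerenkeBBCM1992, Thm. 2.6] -/
theorem exists_continuousOn_extension_holds : exists_continuousOn_extension := by
  intro D φ
  refine ⟨extendFrom (ball 0 1) φ, continuousOn_extendFrom' φ,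
    fun x hx ↦ JordanDomain.extendFrom_eq φ hx,
    ⟨fun x hx ↦ Caratheodory.extendFrom_mem_closure φ hx, Caratheodory.injOn_extendFrom φ,
      Caratheodory.surjOn_extendFrom φ⟩,
    ⟨fun x hx ↦ Caratheodory.extendFrom_mem_frontier φ (mem_sphere_zero_iff_norm.1 hx),
      (Caratheodory.injOn_extendFrom φ).mono sphere_subset_closedBall,
      Caratheodory.surjOn_extendFrom_sphere φ⟩⟩

/-! ### The boundary correspondence in the half-plane form -/

/-- **Carathéodory, half-plane form: the boundary correspondence** (`existsUnique_real_or_infty`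
holds): every boundary point of a Jordan domain `D` is the boundary value of a conformal
equivalence `φ : ℍₒ → D` either at exactly one real point or at infinity. From the disc form
(`exists_continuousOn_extension_holds`, whose injectivity on the circle is what makes the real
point unique) via the Cayley transform (`existsUnique_real_or_infty_of_disc`). Pommerenke (1992),
Thm. 2.6. [cite: PommerenkeBBCM1992, Thm. 2.6] -/
theorem existsUnique_real_or_infty_holds : existsUnique_real_or_infty :=
  existsUnique_real_or_infty_of_disc exists_continuousOn_extension_holds

end JordanDomain

end Literature.Probability.RandomPlanarGeometry
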